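import Mathlib
import Literature.Probability.LatticeModels.TorusFourierWeightedL1
import Literature.Probability.LatticeModels.TorusFourierDyadicInterpolation
import HarnessLib

/-!
# Bernstein's theorem on the discrete torus `(ℤ/Lℤ)^d`: moments of a position kernel from TWO orders of symbol differences

Topic `Probability/LatticeModels`; companion of `TorusFourierWienerBound` / `TorusFourierFirstMoment` / `TorusFourierWeightedL1`
and the torus half of `TorusFourierDyadicInterpolation` (the abstract dyadic interpolation `sum_mul_pow_mul_le_sqrt`: a weighted
`ℓ¹` norm is bounded by `√A` times the GEOMETRIC MEAN `√(B₁B₂)` of two weighted `ℓ²` tail constants of orders `j₁ < a + d/2 < j₂`).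
Here the index set is the discrete torus `(ℤ/Lℤ)^d` with the sup-norm radius `|x̃|_∞ = max_i |x̃_i|` of the centred
representative (volume growth `3^d R^d`), the values are a character sum `g(x) = Σ_k χ_k(x) h(k)` (the conventions of
`TorusFourierWeightedL1`), and the tails come from the weighted Plancherel inequality with PURE differences along the axes
(`sum_weight_mul_norm_sq_le`).  The outcome is the finite, uniform-in-`L` form of Bernstein's theorem (Katznelson, Ch. I §6.3):
a moment of order `a` of the position kernel costs `√(‖Δ^{j₁}h‖ ‖Δ^{j₂}h‖)` for two orders bracketing `a + d/2`, instead of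
more than `a + d/2` differences at once — e.g. the FIRST moment of a `2+1`-dimensional lattice kernel from second and third
differences (`(a,d,j₁,j₂) = (1,3,2,3)`), or of a `2`-dimensional one from first and third (`(1,2,1,3)`).

* `card_filter_supNorm_lt_le` — `#{x : |x̃|_∞ < R} ≤ 3^d R^d` for `R ≥ 1`; `sup_pow_le_sum_pow`;
  `sum_sup_pow_mul_eq_sum_filter` (for `a ≥ 1` the point `x = 0` does not contribute);
* `sum_pow_valMinAbs_mul_norm_sq_le` — `Σ_x |x̃_i|^{2N} ‖g(x)‖² ≤ (L/4)^{2N} L^d Σ_k ‖(Δ_{e_i}^N h)(k)‖²` (weighted Plancherel,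
  pure differences along one axis); `sum_filter_sup_pow_mul_norm_sq_le` — the tail constants from them;
* **`sum_sup_pow_mul_norm_le_sqrt`** — the discrete Bernstein theorem: from `ℓ²` bounds
  `Σ_i Σ_k ‖Δ_{e_i}^{j} h‖² ≤ D_j²` (`j = j₁, j₂` symmetric about `a + d/2`: `2j₁ + m = 2a + d = 2j₂ - m`, `θ = √2`),
  `Σ_{|x̃|_∞ ≥ 1} |x̃|_∞^a ‖g(x)‖ ≤ 2 θ^{2a+d} θ^m/(θ^m-1) · √(3^d) · √((L/4)^{j₁+j₂} L^d D_{j₁} D_{j₂})`;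
* **`sum_sup_pow_mul_norm_le_of_norm_iterate_fwdDiff_le`** — the same from SUP-norm bounds `δ_j` on the differences:
  `≤ 2 θ^{2a+d} θ^m/(θ^m-1) √(3^d) · √d L^d (√(L/4))^{2a+d} √(δ_{j₁} δ_{j₂})`;
* **`sum_sup_pow_mul_norm_le_uniform`** — scaled bounds `‖Δ_{e_i}^{j} h‖ ≤ (c/L)^j E_j` (samples `h(k) = K(2πk/L)` of a
  `C^{j₂}` function: `c = 2π`, `E_j = ‖D^jK‖_∞`) give
  `Σ_{|x̃|_∞ ≥ 1} |x̃|_∞^a ‖g(x)‖ ≤ L^d · 2 θ^{2a+d} θ^m/(θ^m-1) √(3^d) √d (√c/2)^{2a+d} √(E_{j₁}E_{j₂})` — UNIFORM IN `L` for the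
  normalised kernel `L^{-d} g`; `sum_sup_pow_mul_norm_le_uniform_of_one_le` — the same summed over all `x` when `a ≥ 1`.

Everything is proved; no definitions, no named facts.

## Sources

Y. Katznelson, *An Introduction to Harmonic Analysis*, 3rd ed., CUP 2004, Ch. I §6.3 (Bernstein's theorem), pp. 57–58
[`Katznelson2004`]; S. Friedli, Y. Velenik, *Statistical Mechanics of Lattice Systems*, CUP 2017, §10.4 (discrete Fourier
analysis on the torus) [`FriedliVelenik2017`]; G. Benfatto, A. Giuliani, V. Mastropietro, Ann. Henri Poincaré 7 (2006) 809–898,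
Lemma 2.2 and (2.36aa) [`BenfattoGiulianiMastropietro2006`].
-/

noncomputable section

open Finset

namespace Literature.Probability.LatticeModels

/-! ### §2 The discrete torus `(ℤ/Lℤ)^d`: Bernstein's theorem for character sums -/

section Torus

open Complex
open scoped Real ComplexConjugate

variable {d L : ℕ} [NeZero L]

omit [NeZero L] in
/-- Each centred coordinate is bounded by the sup-norm radius `|x̃|_∞ = max_i |x̃_i|`. [folklore] -/
private theorem natAbs_valMinAbs_le_sup (x : TorusSite d L) (i : Fin d) :
    ((x i).valMinAbs.natAbs : ℝ) ≤ ((univ : Finset (Fin d)).sup (fun i => (x i).valMinAbs.natAbs) : ℕ) := by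
  exact_mod_cast Finset.le_sup (f := fun i => (x i).valMinAbs.natAbs) (mem_univ i)

/-- **Volume growth of sup-norm balls on the discrete torus**: `#{x ∈ (ℤ/Lℤ)^d : |x̃|_∞ < R} ≤ 3^d R^d` for `R ≥ 1`
(the centred coordinates embed the ball into `{z ∈ ℤ^d : |z_i| < ⌈R⌉}`) — the `d`-dimensional form of the shell count
"at most `2^{m+1}` terms" in Bernstein's proof. [cite: Katznelson2004, Ch. I §6.3, proof of Theorem (Bernstein), (6.5)] -/
theorem card_filter_supNorm_lt_le {R : ℝ} (hR : 1 ≤ R) :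
    ((((univ : Finset (TorusSite d L)).filter fun x =>
        (((univ : Finset (Fin d)).sup (fun i => (x i).valMinAbs.natAbs) : ℕ) : ℝ) < R).card : ℕ) : ℝ) ≤
      (3 : ℝ) ^ d * R ^ d := by
  classical
  set N := ⌈R⌉₊ with hN
  have hR0 : 0 < R := by linarith
  have hN1 : 1 ≤ N := Nat.one_le_ceil_iff.2 hR0
  have hNR : (N : ℝ) < R + 1 := Nat.ceil_lt_add_one hR0.le
  have hRN : R ≤ N := Nat.le_ceil R
  set F : TorusSite d L → (Fin d → ℤ) := fun x i => (x i).valMinAbs with hF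
  set t : Finset (Fin d → ℤ) := Fintype.piFinset fun _ => Finset.Ioo (-(N : ℤ)) N with ht
  have hmaps : ∀ x ∈ (univ : Finset (TorusSite d L)).filter (fun x =>
      (((univ : Finset (Fin d)).sup (fun i => (x i).valMinAbs.natAbs) : ℕ) : ℝ) < R), F x ∈ t := by
    intro x hx
    rw [mem_filter] at hx
    rw [ht, Fintype.mem_piFinset]
    intro i
    have hi : ((x i).valMinAbs.natAbs : ℝ) < N :=
      ((natAbs_valMinAbs_le_sup x i).trans_lt hx.2).trans_le hRN
    have hi' : ((x i).valMinAbs.natAbs : ℤ) < N := by exact_mod_cast hi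
    rw [Int.natCast_natAbs] at hi'
    rw [Finset.mem_Ioo]
    exact abs_lt.1 hi'
  have hinj : Set.InjOn F ((univ : Finset (TorusSite d L)).filter (fun x =>
      (((univ : Finset (Fin d)).sup (fun i => (x i).valMinAbs.natAbs) : ℕ) : ℝ) < R) : Set (TorusSite d L)) := by
    intro x _ y _ hxy
    funext i
    have h := congr_fun hxy i
    simp only [hF] at h
    rw [← ZMod.coe_valMinAbs (x i), ← ZMod.coe_valMinAbs (y i), h]
  have hcard := Finset.card_le_card_of_injOn F hmaps hinj
  have htcard : t.card = (2 * N - 1) ^ d := by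
    rw [ht, Fintype.card_piFinset, prod_const, card_univ, Fintype.card_fin, Int.card_Ioo]
    congr 1
    omega
  rw [htcard] at hcard
  have h1 : ((2 * N - 1 : ℕ) : ℝ) ≤ 3 * R := by
    have : ((2 * N - 1 : ℕ) : ℝ) = 2 * (N : ℝ) - 1 := by
      rw [Nat.cast_sub (by omega), Nat.cast_mul]; norm_num
    rw [this]; linarith
  calc ((((univ : Finset (TorusSite d L)).filter fun x =>
        (((univ : Finset (Fin d)).sup (fun i => (x i).valMinAbs.natAbs) : ℕ) : ℝ) < R).card : ℕ) : ℝ)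
      ≤ (((2 * N - 1) ^ d : ℕ) : ℝ) := by exact_mod_cast hcard
    _ = (((2 * N - 1 : ℕ) : ℝ)) ^ d := by push_cast; ring
    _ ≤ (3 * R) ^ d := pow_le_pow_left₀ (Nat.cast_nonneg _) h1 d
    _ = (3 : ℝ) ^ d * R ^ d := mul_pow 3 R d

/-- **Weighted Plancherel with pure differences along one axis**: for `g(x) = Σ_k χ_k(x) h(k)` on `(ℤ/Lℤ)^d`,
`Σ_x |x̃_i|^{2N} ‖g(x)‖² ≤ (L/4)^{2N} · L^d · Σ_k ‖(Δ_{e_i}^N h)(k)‖²` (the case `v = e_i` of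
`sum_weight_mul_norm_sq_le`). [cite: BenfattoGiulianiMastropietro2006, Lemma 2.2 and (2.36aa)] -/
theorem sum_pow_valMinAbs_mul_norm_sq_le (h : TorusSite d L → ℂ) (i : Fin d) (N : ℕ) :
    ∑ x : TorusSite d L, ((x i).valMinAbs.natAbs : ℝ) ^ (2 * N) * ‖∑ k, torusChar k x * h k‖ ^ 2 ≤
      ((L : ℝ) / 4) ^ (2 * N) * ((L : ℝ) ^ d * ∑ k, ‖((fwdDiff (Pi.single i 1))^[N] h) k‖ ^ 2) := by
  have hL : (0 : ℝ) < L := Nat.cast_pos.2 (Nat.pos_of_ne_zero (NeZero.ne L))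
  have hw := sum_weight_mul_norm_sq_le h (Pi.single i 1) N
  have hsingle : ∀ x : TorusSite d L, (∑ j, (Pi.single i (1 : ZMod L) : TorusSite d L) j * x j) = x i := by
    intro x
    rw [Finset.sum_eq_single i (fun j _ hj => by rw [Pi.single_eq_of_ne hj, zero_mul])
      (fun hi => absurd (mem_univ i) hi), Pi.single_eq_same, one_mul]
  simp_rw [hsingle] at hw
  calc ∑ x : TorusSite d L, ((x i).valMinAbs.natAbs : ℝ) ^ (2 * N) * ‖∑ k, torusChar k x * h k‖ ^ 2
      = ((L : ℝ) / 4) ^ (2 * N) *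
          ∑ x : TorusSite d L, (4 * |((x i).valMinAbs : ℝ)| / L) ^ (2 * N) * ‖∑ k, torusChar k x * h k‖ ^ 2 := by
        rw [mul_sum]
        refine sum_congr rfl fun x _ => ?_
        rw [← mul_assoc, ← mul_pow, Nat.cast_natAbs, Int.cast_abs]
        congr 2
        field_simp
    _ ≤ ((L : ℝ) / 4) ^ (2 * N) * ((L : ℝ) ^ d * ∑ k, ‖((fwdDiff (Pi.single i 1))^[N] h) k‖ ^ 2) :=
        mul_le_mul_of_nonneg_left hw (by positivity)

omit [NeZero L] in
/-- On `{1 ≤ |x̃|_∞}` the `j`-th power of the sup-norm radius is dominated by the sum of the coordinate powers: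
`|x̃|_∞^{j} ≤ Σ_i |x̃_i|^{j}`. [folklore] -/
private theorem sup_pow_le_sum_pow (x : TorusSite d L) (j : ℕ)
    (hx : (1 : ℝ) ≤ (((univ : Finset (Fin d)).sup (fun i => (x i).valMinAbs.natAbs) : ℕ) : ℝ)) :
    ((((univ : Finset (Fin d)).sup (fun i => (x i).valMinAbs.natAbs) : ℕ) : ℝ)) ^ j ≤
      ∑ i : Fin d, ((x i).valMinAbs.natAbs : ℝ) ^ j := by
  have hne : (univ : Finset (Fin d)).Nonempty := by
    rcases Nat.eq_zero_or_pos d with hd | hd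
    · subst hd
      exfalso
      have h0 : (univ : Finset (Fin 0)).sup (fun i => (x i).valMinAbs.natAbs) = 0 := by simp
      rw [h0] at hx
      norm_num at hx
    · exact ⟨⟨0, hd⟩, mem_univ _⟩
  obtain ⟨i, -, hi⟩ := Finset.exists_mem_eq_sup univ hne (fun i => (x i).valMinAbs.natAbs)
  rw [hi]
  exact single_le_sum (f := fun i => ((x i).valMinAbs.natAbs : ℝ) ^ j) (fun i _ => by positivity) (mem_univ i)

/-- For a moment of order `a ≥ 1` the point `x = 0` (the only point with `|x̃|_∞ < 1`) does not contribute: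
`Σ_x |x̃|_∞^a F(x) = Σ_{|x̃|_∞ ≥ 1} |x̃|_∞^a F(x)`. [folklore] -/
private theorem sum_sup_pow_mul_eq_sum_filter (F : TorusSite d L → ℝ) {a : ℕ} (ha : 1 ≤ a) :
    ∑ x : TorusSite d L, ((((univ : Finset (Fin d)).sup (fun i => (x i).valMinAbs.natAbs) : ℕ) : ℝ)) ^ a * F x =
      ∑ x ∈ (univ : Finset (TorusSite d L)).filter
          (fun x => (1 : ℝ) ≤ (((univ : Finset (Fin d)).sup (fun i => (x i).valMinAbs.natAbs) : ℕ) : ℝ)),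
        ((((univ : Finset (Fin d)).sup (fun i => (x i).valMinAbs.natAbs) : ℕ) : ℝ)) ^ a * F x := by
  rw [← sum_filter_add_sum_filter_not univ
    (fun x : TorusSite d L => (1 : ℝ) ≤ (((univ : Finset (Fin d)).sup (fun i => (x i).valMinAbs.natAbs) : ℕ) : ℝ))]
  rw [add_eq_left]
  refine sum_eq_zero fun x hx => ?_
  have hx' := (mem_filter.1 hx).2
  have h0 : ((univ : Finset (Fin d)).sup (fun i => (x i).valMinAbs.natAbs) : ℕ) = 0 := by
    by_contra h
    exact hx' (by exact_mod_cast Nat.one_le_iff_ne_zero.2 h)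
  rw [h0, Nat.cast_zero, zero_pow (by omega), zero_mul]

/-- **The tail constants from pure differences**: for `g(x) = Σ_k χ_k(x) h(k)`,
`Σ_{|x̃|_∞ ≥ 1} |x̃|_∞^{2j} ‖g(x)‖² ≤ (L/4)^{2j} L^d Σ_i Σ_k ‖(Δ_{e_i}^j h)(k)‖²`. [cite: Katznelson2004, Ch. I §6.3, (6.4)] -/
theorem sum_filter_sup_pow_mul_norm_sq_le (h : TorusSite d L → ℂ) (j : ℕ) :
    ∑ x ∈ (univ : Finset (TorusSite d L)).filter
        (fun x => (1 : ℝ) ≤ (((univ : Finset (Fin d)).sup (fun i => (x i).valMinAbs.natAbs) : ℕ) : ℝ)),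
      (1 : ℝ) * ((((univ : Finset (Fin d)).sup (fun i => (x i).valMinAbs.natAbs) : ℕ) : ℝ)) ^ (2 * j) *
        ‖∑ k, torusChar k x * h k‖ ^ 2 ≤
      ((L : ℝ) / 4) ^ (2 * j) * ((L : ℝ) ^ d * ∑ i : Fin d, ∑ k, ‖((fwdDiff (Pi.single i 1))^[j] h) k‖ ^ 2) := by
  calc ∑ x ∈ (univ : Finset (TorusSite d L)).filter
        (fun x => (1 : ℝ) ≤ (((univ : Finset (Fin d)).sup (fun i => (x i).valMinAbs.natAbs) : ℕ) : ℝ)),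
      (1 : ℝ) * ((((univ : Finset (Fin d)).sup (fun i => (x i).valMinAbs.natAbs) : ℕ) : ℝ)) ^ (2 * j) *
        ‖∑ k, torusChar k x * h k‖ ^ 2
      ≤ ∑ x ∈ (univ : Finset (TorusSite d L)).filter
          (fun x => (1 : ℝ) ≤ (((univ : Finset (Fin d)).sup (fun i => (x i).valMinAbs.natAbs) : ℕ) : ℝ)),
          (∑ i : Fin d, ((x i).valMinAbs.natAbs : ℝ) ^ (2 * j)) * ‖∑ k, torusChar k x * h k‖ ^ 2 := by
        refine sum_le_sum fun x hx => ?_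
        rw [one_mul]
        exact mul_le_mul_of_nonneg_right (sup_pow_le_sum_pow x (2 * j) (mem_filter.1 hx).2) (sq_nonneg _)
    _ ≤ ∑ x : TorusSite d L, (∑ i : Fin d, ((x i).valMinAbs.natAbs : ℝ) ^ (2 * j)) * ‖∑ k, torusChar k x * h k‖ ^ 2 :=
        sum_le_sum_of_subset_of_nonneg (filter_subset _ _) fun x _ _ => by positivity
    _ = ∑ i : Fin d, ∑ x : TorusSite d L, ((x i).valMinAbs.natAbs : ℝ) ^ (2 * j) * ‖∑ k, torusChar k x * h k‖ ^ 2 := by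
        rw [sum_comm]
        exact sum_congr rfl fun x _ => sum_mul _ _ _
    _ ≤ ∑ i : Fin d, ((L : ℝ) / 4) ^ (2 * j) * ((L : ℝ) ^ d * ∑ k, ‖((fwdDiff (Pi.single i 1))^[j] h) k‖ ^ 2) :=
        sum_le_sum fun i _ => sum_pow_valMinAbs_mul_norm_sq_le h i j
    _ = ((L : ℝ) / 4) ^ (2 * j) * ((L : ℝ) ^ d * ∑ i : Fin d, ∑ k, ‖((fwdDiff (Pi.single i 1))^[j] h) k‖ ^ 2) := by
        conv_rhs => rw [mul_sum, mul_sum]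

/-- **Bernstein's theorem on the discrete torus (ℓ² form).**  Let `g(x) = Σ_k χ_k(x) h(k)` on `(ℤ/Lℤ)^d` and let
`j₁ < a + d/2 < j₂` be symmetric about `a + d/2` (`2j₁ + m = 2a + d = 2j₂ - m`, `m ≥ 1`).  If the pure `j₁`-th and `j₂`-th
differences of the symbol along the axes have `ℓ²` sizes `Σ_i Σ_k ‖Δ_{e_i}^{j} h‖² ≤ D_j²`, then, with `θ = √2`,
`Σ_{|x̃|_∞ ≥ 1} |x̃|_∞^a ‖g(x)‖ ≤ 2 θ^{2a+d} θ^m/(θ^m - 1) · √(3^d) · √((L/4)^{j₁+j₂} · L^d · D_{j₁} D_{j₂})`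
— the moment of order `a` of the position kernel costs the GEOMETRIC MEAN of the two difference orders (the term `x = 0` is
excluded; it carries the factor `|x̃|_∞^a = 0` for `a ≥ 1`). [cite: Katznelson2004, Ch. I §6.3, Theorem (Bernstein), pp. 57–58] -/
theorem sum_sup_pow_mul_norm_le_sqrt (h : TorusSite d L → ℂ) {a j₁ j₂ m : ℕ} (hm₁ : 2 * j₁ + m = 2 * a + d)
    (hm₂ : 2 * a + d + m = 2 * j₂) (hm0 : 0 < m) {D₁ D₂ : ℝ} (hD₁ : 0 ≤ D₁) (hD₂ : 0 ≤ D₂)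
    (hdiff₁ : ∑ i : Fin d, ∑ k, ‖((fwdDiff (Pi.single i 1))^[j₁] h) k‖ ^ 2 ≤ D₁ ^ 2)
    (hdiff₂ : ∑ i : Fin d, ∑ k, ‖((fwdDiff (Pi.single i 1))^[j₂] h) k‖ ^ 2 ≤ D₂ ^ 2) :
    ∑ x ∈ (univ : Finset (TorusSite d L)).filter
        (fun x => (1 : ℝ) ≤ (((univ : Finset (Fin d)).sup (fun i => (x i).valMinAbs.natAbs) : ℕ) : ℝ)),
      ((((univ : Finset (Fin d)).sup (fun i => (x i).valMinAbs.natAbs) : ℕ) : ℝ)) ^ a * ‖∑ k, torusChar k x * h k‖ ≤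
      2 * Real.sqrt 2 ^ (2 * a + d) * (Real.sqrt 2 ^ m / (Real.sqrt 2 ^ m - 1)) * Real.sqrt ((3 : ℝ) ^ d) *
        Real.sqrt (((L : ℝ) / 4) ^ (j₁ + j₂) * (L : ℝ) ^ d * (D₁ * D₂)) := by
  have hL : (0 : ℝ) ≤ L := Nat.cast_nonneg _
  set B₁ : ℝ := ((L : ℝ) / 4) ^ j₁ * Real.sqrt ((L : ℝ) ^ d) * D₁ with hB₁
  set B₂ : ℝ := ((L : ℝ) / 4) ^ j₂ * Real.sqrt ((L : ℝ) ^ d) * D₂ with hB₂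
  have hB : ∀ (j : ℕ) (D : ℝ), 0 ≤ D → ∑ i : Fin d, ∑ k, ‖((fwdDiff (Pi.single i 1))^[j] h) k‖ ^ 2 ≤ D ^ 2 →
      ∑ x ∈ (univ : Finset (TorusSite d L)).filter
          (fun x => (1 : ℝ) ≤ (((univ : Finset (Fin d)).sup (fun i => (x i).valMinAbs.natAbs) : ℕ) : ℝ)),
        (1 : ℝ) * ((((univ : Finset (Fin d)).sup (fun i => (x i).valMinAbs.natAbs) : ℕ) : ℝ)) ^ (2 * j) *
          ‖∑ k, torusChar k x * h k‖ ^ 2 ≤ (((L : ℝ) / 4) ^ j * Real.sqrt ((L : ℝ) ^ d) * D) ^ 2 := by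
    intro j D hD hdiff
    refine (sum_filter_sup_pow_mul_norm_sq_le h j).trans ?_
    rw [mul_pow, mul_pow, Real.sq_sqrt (by positivity), ← pow_mul, mul_comm j 2, mul_assoc]
    exact mul_le_mul_of_nonneg_left (mul_le_mul_of_nonneg_left hdiff (by positivity)) (by positivity)
  have hmain := sum_mul_pow_mul_le_sqrt (univ : Finset (TorusSite d L)) (fun _ => (1 : ℝ))
    (fun x => ‖∑ k, torusChar k x * h k‖)
    (fun x => ((((univ : Finset (Fin d)).sup (fun i => (x i).valMinAbs.natAbs) : ℕ) : ℝ)))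
    (fun _ _ => zero_le_one) (fun _ _ => norm_nonneg _) (fun _ _ => Nat.cast_nonneg _) hm₁ hm₂ hm0
    (A := (3 : ℝ) ^ d) (by positivity) (by positivity : 0 ≤ B₁) (by positivity : 0 ≤ B₂)
    (fun R hR => by rw [sum_const, nsmul_eq_mul, mul_one]; exact card_filter_supNorm_lt_le hR)
    (hB j₁ D₁ hD₁ hdiff₁) (hB j₂ D₂ hD₂ hdiff₂)
  simp only [one_mul] at hmain
  refine hmain.trans (le_of_eq ?_)
  congr 1
  rw [hB₁, hB₂]
  congr 1
  have : Real.sqrt ((L : ℝ) ^ d) * Real.sqrt ((L : ℝ) ^ d) = (L : ℝ) ^ d := Real.mul_self_sqrt (by positivity)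
  rw [pow_add]
  linear_combination ((L : ℝ) / 4) ^ j₁ * ((L : ℝ) / 4) ^ j₂ * D₁ * D₂ * this

/-- `√(x^n) = (√x)^n` for `x ≥ 0`. [folklore] -/
private theorem sqrt_pow_eq (x : ℝ) (hx : 0 ≤ x) (n : ℕ) : Real.sqrt (x ^ n) = Real.sqrt x ^ n := by
  rw [show x ^ n = (Real.sqrt x ^ n) ^ 2 by rw [← pow_mul, mul_comm, pow_mul, Real.sq_sqrt hx],
    Real.sqrt_sq (pow_nonneg (Real.sqrt_nonneg _) _)]

/-- **Bernstein's theorem on the discrete torus (sup-norm form).**  If the pure `j₁`-th and `j₂`-th differences of the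
symbol along every axis are bounded pointwise, `‖(Δ_{e_i}^{j} h)(k)‖ ≤ δ_j` (`2j₁ + m = 2a + d = 2j₂ - m`, `m ≥ 1`), then
`Σ_{|x̃|_∞ ≥ 1} |x̃|_∞^a ‖g(x)‖ ≤ 2 θ^{2a+d} θ^m/(θ^m-1) · √(3^d) · √d · L^d · (√(L/4))^{2a+d} · √(δ_{j₁} δ_{j₂})`,
`g(x) = Σ_k χ_k(x) h(k)`, `θ = √2`. [cite: Katznelson2004, Ch. I §6.3, Theorem (Bernstein), pp. 57–58] -/
theorem sum_sup_pow_mul_norm_le_of_norm_iterate_fwdDiff_le (h : TorusSite d L → ℂ) {a j₁ j₂ m : ℕ}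
    (hm₁ : 2 * j₁ + m = 2 * a + d) (hm₂ : 2 * a + d + m = 2 * j₂) (hm0 : 0 < m) {δ₁ δ₂ : ℝ} (hδ₁ : 0 ≤ δ₁)
    (hδ₂ : 0 ≤ δ₂) (hsup₁ : ∀ (i : Fin d) (k : TorusSite d L), ‖((fwdDiff (Pi.single i 1))^[j₁] h) k‖ ≤ δ₁)
    (hsup₂ : ∀ (i : Fin d) (k : TorusSite d L), ‖((fwdDiff (Pi.single i 1))^[j₂] h) k‖ ≤ δ₂) :
    ∑ x ∈ (univ : Finset (TorusSite d L)).filter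
        (fun x => (1 : ℝ) ≤ (((univ : Finset (Fin d)).sup (fun i => (x i).valMinAbs.natAbs) : ℕ) : ℝ)),
      ((((univ : Finset (Fin d)).sup (fun i => (x i).valMinAbs.natAbs) : ℕ) : ℝ)) ^ a * ‖∑ k, torusChar k x * h k‖ ≤
      2 * Real.sqrt 2 ^ (2 * a + d) * (Real.sqrt 2 ^ m / (Real.sqrt 2 ^ m - 1)) * Real.sqrt ((3 : ℝ) ^ d) *
        (Real.sqrt d * (L : ℝ) ^ d * Real.sqrt ((L : ℝ) / 4) ^ (2 * a + d) * Real.sqrt (δ₁ * δ₂)) := by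
  have hL : (0 : ℝ) ≤ L := Nat.cast_nonneg _
  have hcard : (Fintype.card (TorusSite d L) : ℝ) = (L : ℝ) ^ d := by
    exact_mod_cast (by simp [ZMod.card] : Fintype.card (TorusSite d L) = L ^ d)
  have hD : ∀ (j : ℕ) (δ : ℝ), (∀ (i : Fin d) (k : TorusSite d L), ‖((fwdDiff (Pi.single i 1))^[j] h) k‖ ≤ δ) →
      ∑ i : Fin d, ∑ k, ‖((fwdDiff (Pi.single i 1))^[j] h) k‖ ^ 2 ≤ (Real.sqrt ((d : ℝ) * (L : ℝ) ^ d) * δ) ^ 2 := by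
    intro j δ hδ
    calc ∑ i : Fin d, ∑ k, ‖((fwdDiff (Pi.single i 1))^[j] h) k‖ ^ 2
        ≤ ∑ i : Fin d, ∑ k : TorusSite d L, δ ^ 2 :=
          sum_le_sum fun i _ => sum_le_sum fun k _ => pow_le_pow_left₀ (norm_nonneg _) (hδ i k) 2
      _ = (d : ℝ) * ((L : ℝ) ^ d * δ ^ 2) := by
          simp only [sum_const, nsmul_eq_mul, card_univ, Fintype.card_fin]
          rw [hcard]
      _ = (Real.sqrt ((d : ℝ) * (L : ℝ) ^ d) * δ) ^ 2 := by
          rw [mul_pow, Real.sq_sqrt (by positivity)]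
          ring
  have hj : j₁ + j₂ = 2 * a + d := by omega
  refine (sum_sup_pow_mul_norm_le_sqrt h hm₁ hm₂ hm0 (by positivity) (by positivity) (hD j₁ δ₁ hsup₁)
    (hD j₂ δ₂ hsup₂)).trans (le_of_eq ?_)
  congr 1
  have e1 : Real.sqrt (d : ℝ) ^ 2 = d := Real.sq_sqrt (Nat.cast_nonneg d)
  have e2 : (Real.sqrt ((L : ℝ) / 4) ^ (2 * a + d)) ^ 2 = ((L : ℝ) / 4) ^ (2 * a + d) := by
    rw [← pow_mul, mul_comm, pow_mul, Real.sq_sqrt (by positivity)]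
  have e3 : Real.sqrt (δ₁ * δ₂) ^ 2 = δ₁ * δ₂ := Real.sq_sqrt (mul_nonneg hδ₁ hδ₂)
  have e4 : Real.sqrt ((d : ℝ) * (L : ℝ) ^ d) ^ 2 = (d : ℝ) * (L : ℝ) ^ d := Real.sq_sqrt (by positivity)
  have hX : ((L : ℝ) / 4) ^ (j₁ + j₂) * (L : ℝ) ^ d *
      (Real.sqrt ((d : ℝ) * (L : ℝ) ^ d) * δ₁ * (Real.sqrt ((d : ℝ) * (L : ℝ) ^ d) * δ₂)) =
      (Real.sqrt d * (L : ℝ) ^ d * Real.sqrt ((L : ℝ) / 4) ^ (2 * a + d) * Real.sqrt (δ₁ * δ₂)) ^ 2 := by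
    rw [hj, mul_pow, mul_pow, mul_pow, e1, e2, e3,
      show Real.sqrt ((d : ℝ) * (L : ℝ) ^ d) * δ₁ * (Real.sqrt ((d : ℝ) * (L : ℝ) ^ d) * δ₂) =
        Real.sqrt ((d : ℝ) * (L : ℝ) ^ d) ^ 2 * (δ₁ * δ₂) by ring, e4]
    ring
  rw [hX, Real.sqrt_sq (by positivity)]

/-- **Bernstein's theorem on the discrete torus, uniform-in-`L` form for sampled symbols.**  If the pure differences of
the symbol obey the SCALED bounds `‖(Δ_{e_i}^{j} h)(k)‖ ≤ (c/L)^{j} E_j` for `j = j₁, j₂` (the shape delivered by the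
mean-value theorem for the samples `h(k) = K(2πk/L)` of a `C^{j₂}` function: `c = 2π`, `E_j = ‖D^jK‖_∞`), then
`Σ_{|x̃|_∞ ≥ 1} |x̃|_∞^a ‖g(x)‖ ≤ L^d · [2 θ^{2a+d} θ^m/(θ^m-1) · √(3^d) · √d · (√(c/4))^{2a+d} · √(E_{j₁} E_{j₂})]`:
the moment of order `a < j₂ - d/2` of the normalised position kernel `L^{-d} g` is bounded UNIFORMLY IN `L` by the
geometric mean `√(‖D^{j₁}K‖ ‖D^{j₂}K‖)`. [cite: Katznelson2004, Ch. I §6.3, Theorem (Bernstein), pp. 57–58] -/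
theorem sum_sup_pow_mul_norm_le_uniform (h : TorusSite d L → ℂ) {a j₁ j₂ m : ℕ}
    (hm₁ : 2 * j₁ + m = 2 * a + d) (hm₂ : 2 * a + d + m = 2 * j₂) (hm0 : 0 < m) {c E₁ E₂ : ℝ} (hc : 0 ≤ c)
    (hE₁ : 0 ≤ E₁) (hE₂ : 0 ≤ E₂)
    (hsup₁ : ∀ (i : Fin d) (k : TorusSite d L), ‖((fwdDiff (Pi.single i 1))^[j₁] h) k‖ ≤ (c / L) ^ j₁ * E₁)
    (hsup₂ : ∀ (i : Fin d) (k : TorusSite d L), ‖((fwdDiff (Pi.single i 1))^[j₂] h) k‖ ≤ (c / L) ^ j₂ * E₂) :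
    ∑ x ∈ (univ : Finset (TorusSite d L)).filter
        (fun x => (1 : ℝ) ≤ (((univ : Finset (Fin d)).sup (fun i => (x i).valMinAbs.natAbs) : ℕ) : ℝ)),
      ((((univ : Finset (Fin d)).sup (fun i => (x i).valMinAbs.natAbs) : ℕ) : ℝ)) ^ a * ‖∑ k, torusChar k x * h k‖ ≤
      (L : ℝ) ^ d * (2 * Real.sqrt 2 ^ (2 * a + d) * (Real.sqrt 2 ^ m / (Real.sqrt 2 ^ m - 1)) * Real.sqrt ((3 : ℝ) ^ d) *
        (Real.sqrt d * Real.sqrt (c / 4) ^ (2 * a + d) * Real.sqrt (E₁ * E₂))) := by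
  have hL : (0 : ℝ) < L := Nat.cast_pos.2 (Nat.pos_of_ne_zero (NeZero.ne L))
  have hj : j₁ + j₂ = 2 * a + d := by omega
  refine (sum_sup_pow_mul_norm_le_of_norm_iterate_fwdDiff_le h hm₁ hm₂ hm0 (by positivity) (by positivity)
    hsup₁ hsup₂).trans (le_of_eq ?_)
  have hδ : Real.sqrt ((c / L) ^ j₁ * E₁ * ((c / L) ^ j₂ * E₂)) = Real.sqrt (c / L) ^ (2 * a + d) * Real.sqrt (E₁ * E₂) := by
    rw [show (c / L) ^ j₁ * E₁ * ((c / L) ^ j₂ * E₂) = (c / L) ^ (j₁ + j₂) * (E₁ * E₂) by rw [pow_add]; ring, hj,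
      Real.sqrt_mul (by positivity), sqrt_pow_eq _ (by positivity)]
  have hcL : Real.sqrt ((L : ℝ) / 4) * Real.sqrt (c / L) = Real.sqrt (c / 4) := by
    rw [← Real.sqrt_mul (by positivity)]
    congr 1
    field_simp
  rw [hδ]
  calc 2 * Real.sqrt 2 ^ (2 * a + d) * (Real.sqrt 2 ^ m / (Real.sqrt 2 ^ m - 1)) * Real.sqrt ((3 : ℝ) ^ d) *
        (Real.sqrt d * (L : ℝ) ^ d * Real.sqrt ((L : ℝ) / 4) ^ (2 * a + d) *
          (Real.sqrt (c / L) ^ (2 * a + d) * Real.sqrt (E₁ * E₂)))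
      = (L : ℝ) ^ d * (2 * Real.sqrt 2 ^ (2 * a + d) * (Real.sqrt 2 ^ m / (Real.sqrt 2 ^ m - 1)) *
          Real.sqrt ((3 : ℝ) ^ d) *
          (Real.sqrt d * (Real.sqrt ((L : ℝ) / 4) * Real.sqrt (c / L)) ^ (2 * a + d) * Real.sqrt (E₁ * E₂))) := by
        rw [mul_pow]; ring
    _ = _ := by rw [hcL]

/-- **Bernstein's theorem on the discrete torus, uniform-in-`L` form, full sum for `a ≥ 1`.**  As
`sum_sup_pow_mul_norm_le_uniform`, summed over ALL `x` (for a moment of order `a ≥ 1` the point `x = 0` carries the factor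
`|x̃|_∞^a = 0`): `Σ_x |x̃|_∞^a ‖g(x)‖ ≤ L^d · 2 θ^{2a+d} θ^m/(θ^m-1) √(3^d) √d (√(c/4))^{2a+d} √(E_{j₁}E_{j₂})`.
[cite: Katznelson2004, Ch. I §6.3, Theorem (Bernstein), pp. 57–58] -/
theorem sum_sup_pow_mul_norm_le_uniform_of_one_le (h : TorusSite d L → ℂ) {a j₁ j₂ m : ℕ} (ha : 1 ≤ a)
    (hm₁ : 2 * j₁ + m = 2 * a + d) (hm₂ : 2 * a + d + m = 2 * j₂) (hm0 : 0 < m) {c E₁ E₂ : ℝ} (hc : 0 ≤ c)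
    (hE₁ : 0 ≤ E₁) (hE₂ : 0 ≤ E₂)
    (hsup₁ : ∀ (i : Fin d) (k : TorusSite d L), ‖((fwdDiff (Pi.single i 1))^[j₁] h) k‖ ≤ (c / L) ^ j₁ * E₁)
    (hsup₂ : ∀ (i : Fin d) (k : TorusSite d L), ‖((fwdDiff (Pi.single i 1))^[j₂] h) k‖ ≤ (c / L) ^ j₂ * E₂) :
    ∑ x : TorusSite d L,
      ((((univ : Finset (Fin d)).sup (fun i => (x i).valMinAbs.natAbs) : ℕ) : ℝ)) ^ a * ‖∑ k, torusChar k x * h k‖ ≤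
      (L : ℝ) ^ d * (2 * Real.sqrt 2 ^ (2 * a + d) * (Real.sqrt 2 ^ m / (Real.sqrt 2 ^ m - 1)) * Real.sqrt ((3 : ℝ) ^ d) *
        (Real.sqrt d * Real.sqrt (c / 4) ^ (2 * a + d) * Real.sqrt (E₁ * E₂))) := by
  rw [sum_sup_pow_mul_eq_sum_filter (fun x => ‖∑ k, torusChar k x * h k‖) ha]
  exact sum_sup_pow_mul_norm_le_uniform h hm₁ hm₂ hm0 hc hE₁ hE₂ hsup₁ hsup₂

end Torus

end Literature.Probability.LatticeModels

end
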